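import Literature.Analysis.FluidPDE.HessianLaplacian
import Literature.Analysis.FluidPDE.VectorCalculus
import Literature.Analysis.FluidPDE.CubeShellDivergence
import HarnessLib

/-!
# Crux `FarPastLedger` (stmt-NavierStokesRegularity-14060), line `uloc-gronwall-transplant`, negative side: the gradient bound of stub HA (`stub_fplSlicePressure`) is load-bearing

Negative-side (cdisprove, D-0016) lemma for the lead's hardest stub `stub_fplSlicePressure` (slice
harmonic analysis: any smooth `q` with `Δq = −div((w·∇)w)`, `‖∇q‖ ≤ L`, `w` smooth bounded
divergence free, has the near/far structure `q = c + ⟪a,·⟫ + p₁ + p₂` on every ball `B₂(x₀)` with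
`‖p₁‖₂² ≤ c₀M²∫_{B₄(x₀)}‖w‖²` and `‖∇p₂‖ ≤ c₀∫_{|y−x₀|≥3}‖w‖²|y−x₀|⁻⁴` on `B₂(x₀)`).

* `no_nearFar_decomposition_harmonicQuadratic` — for `w = 0` the harmonic quadratic `q(y) = y₀y₁`
  admits NO decomposition `q = c + ⟪a,·⟫ + p₁ + p₂` on `B₂(0)` with `p₁ = 0` in `L²` and `∇p₂ = 0`
  on `B₂(0)` (second differences of `y₀y₁` at the four points `(±½, ±½, 0)` do not vanish);
* `slicePressure_false_without_gradBound` — hence the stub with the hypothesis `‖∇q‖ ≤ L` DELETED is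
  FALSE (at `M = 0`, `w = 0`, `q = y₀y₁`, which solves `Δq = −div((w·∇)w) = 0`): the bounded pressure
  gradient (stub GRADP, `stub_fplPressureGradientBound`, KNSS smoothing) is genuinely consumed by HA —
  it is what excludes the harmonic polynomials of degree ≥ 2 from the kernel of the pressure Poisson
  equation, leaving only the affine mode that stub PIN then pins to `0`.

Nothing here asserts a route statement; `--supports` the crux item.
-/

noncomputable section

set_option linter.dupNamespace false

namespace Summit.NavierStokesRegularity.NavierStokesRegularity.Theorems.FarPastLedger.Negative

open MeasureTheory Set Filter Metric
open scoped Topology Laplacian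
open Literature.Analysis.FluidPDE
open Literature.Analysis.FluidPDE.CubeShell (contDiff_coord)

local notation "ℝ³" => EuclideanSpace ℝ (Fin 3)

/-! ## Coordinate calculus: the harmonic quadratic `y₀ y₁` -/

/-- `D(y ↦ yᵢ)(x) h = hᵢ`. -/
theorem fderiv_coord_apply (i : Fin 3) (x h : ℝ³) :
    fderiv ℝ (fun y : ℝ³ => y i) x h = h i := by
  have : (fun y : ℝ³ => y i) = ⇑(EuclideanSpace.proj (𝕜 := ℝ) i) := rfl
  rw [this, ContinuousLinearMap.fderiv]
  rfl

/-- `Δ(y ↦ yᵢ) = 0`. -/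
theorem laplacian_coord (i : Fin 3) (x : ℝ³) : (Δ (fun y : ℝ³ => y i)) x = 0 := by
  rw [laplacian_eq_sum_fderiv_fderiv (EuclideanSpace.basisFun (Fin 3) ℝ) (contDiff_coord i) x]
  refine Finset.sum_eq_zero fun j _ => ?_
  have : (fun y : ℝ³ => fderiv ℝ (fun y : ℝ³ => y i) y ((EuclideanSpace.basisFun (Fin 3) ℝ) j)) =
      fun _ => ((EuclideanSpace.basisFun (Fin 3) ℝ) j) i := by
    funext y; exact fderiv_coord_apply i y _
  rw [this, fderiv_fun_const]
  rfl

/-- The harmonic quadratic `q(y) = y₀ y₁`. -/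
def harmonicQuadratic : ℝ³ → ℝ := fun y => y 0 * y 1

/-- `y₀y₁` is smooth. -/
theorem contDiff_harmonicQuadratic {n : WithTop ℕ∞} : ContDiff ℝ n harmonicQuadratic :=
  (contDiff_coord 0).mul (contDiff_coord 1)

/-- `Δ(y₀y₁) = 0` (Leibniz rule `laplacian_mul_eq`, `Δyᵢ = 0`, `⟪e₀, e₁⟫ = 0`). -/
theorem laplacian_harmonicQuadratic (x : ℝ³) : (Δ harmonicQuadratic) x = 0 := by
  show (Δ fun y : ℝ³ => y 0 * y 1) x = 0
  rw [laplacian_mul_eq (EuclideanSpace.basisFun (Fin 3) ℝ) (contDiff_coord 0) (contDiff_coord 1) x,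
    laplacian_coord, laplacian_coord]
  simp only [fderiv_coord_apply, mul_zero, zero_add, Fin.sum_univ_three, EuclideanSpace.basisFun_apply]
  simp

/-- The test points `s e₀ + t e₁`. -/
def testPoint (s t : ℝ) : ℝ³ := EuclideanSpace.single 0 s + EuclideanSpace.single 1 t

/-- `q(s e₀ + t e₁) = s t`. -/
theorem harmonicQuadratic_testPoint (s t : ℝ) : harmonicQuadratic (testPoint s t) = s * t := by
  simp [harmonicQuadratic, testPoint]

/-- `‖s e₀ + t e₁‖ ≤ |s| + |t|`. -/
theorem norm_testPoint_le (s t : ℝ) : ‖testPoint s t‖ ≤ |s| + |t| := by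
  unfold testPoint
  refine (norm_add_le _ _).trans ?_
  simp

/-- `⟪a, s e₀ + t e₁⟫ = s a₀ + t a₁`. -/
theorem inner_testPoint (a : ℝ³) (s t : ℝ) : inner ℝ a (testPoint s t) = s * a 0 + t * a 1 := by
  simp [testPoint, inner_add_right, EuclideanSpace.inner_single_right]

/-- The four points `(±½, ±½, 0)` lie in `B₂(0)`. -/
theorem testPoint_mem_ball {s t : ℝ} (hs : |s| = 1 / 2) (ht : |t| = 1 / 2) :
    testPoint s t ∈ ball (0 : ℝ³) 2 := by
  rw [mem_ball_zero_iff]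
  refine (norm_testPoint_le _ _).trans_lt ?_
  rw [hs, ht]; norm_num

/-! ## No near/far decomposition of `y₀y₁` with trivial near and far parts -/

/-- **Core obstruction.** `y₀y₁` is not of the form `c + ⟪a,·⟫ + p₁ + p₂` on `B₂(0)` with `p₁ = 0`
in `L²(ℝ³)` and `p₂` differentiable with `∇p₂ = 0` on `B₂(0)`: `p₂` is then constant on the ball,
`p₁` vanishes a.e., so the continuous function `y₀y₁ − c − ⟪a,y⟫ − p₂` vanishes identically on the
open ball (`Measure.eqOn_open_of_ae_eq`), which the second difference over `(±½, ±½, 0)` refutes. -/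
theorem no_nearFar_decomposition_harmonicQuadratic :
    ¬ ∃ (a : ℝ³) (c : ℝ) (p₁ p₂ : ℝ³ → ℝ),
      (∀ x ∈ ball (0 : ℝ³) 2, harmonicQuadratic x = c + inner ℝ a x + p₁ x + p₂ x) ∧
      MemLp p₁ 2 volume ∧ ∫ x, p₁ x ^ 2 ≤ 0 ∧
      ∀ x ∈ ball (0 : ℝ³) 2, DifferentiableAt ℝ p₂ x ∧ ‖fderiv ℝ p₂ x‖ ≤ 0 := by
  rintro ⟨a, c, p₁, p₂, hdec, hmem, hint, hfar⟩
  -- `p₂` is constant on the ball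
  have hconst : ∀ x ∈ ball (0 : ℝ³) 2, p₂ x = p₂ 0 := by
    intro x hx
    have key := Convex.norm_image_sub_le_of_norm_fderiv_le (𝕜 := ℝ) (f := p₂) (C := 0)
      (fun y hy => (hfar y hy).1) (fun y hy => (hfar y hy).2) (convex_ball (0 : ℝ³) 2)
      (mem_ball_self two_pos) hx
    rw [zero_mul, norm_le_zero_iff, sub_eq_zero] at key
    exact key
  -- `p₁ = 0` a.e.
  have hsq_int : Integrable (fun x => p₁ x ^ 2) volume := hmem.integrable_sq
  have hsq_zero : ∫ x, p₁ x ^ 2 = 0 :=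
    le_antisymm hint (integral_nonneg fun x => sq_nonneg _)
  have hp1ae : ∀ᵐ x ∂(volume : Measure ℝ³), p₁ x = 0 := by
    have h := (integral_eq_zero_iff_of_nonneg (fun x => sq_nonneg (p₁ x)) hsq_int).1 hsq_zero
    filter_upwards [h] with x hx
    simpa using hx
  -- the continuous remainder vanishes a.e. on the ball, hence everywhere on it
  set g : ℝ³ → ℝ := fun x => harmonicQuadratic x - c - inner ℝ a x - p₂ x with hg
  have hgae : g =ᵐ[volume.restrict (ball (0 : ℝ³) 2)] fun _ => (0 : ℝ) := by
    have h1 : ∀ᵐ x ∂(volume.restrict (ball (0 : ℝ³) 2)), p₁ x = 0 := ae_restrict_of_ae hp1ae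
    have h2 : ∀ᵐ x ∂(volume.restrict (ball (0 : ℝ³) 2)), x ∈ ball (0 : ℝ³) 2 :=
      ae_restrict_mem measurableSet_ball
    filter_upwards [h1, h2] with x hx1 hx2
    have := hdec x hx2
    simp only [hg]
    linarith
  have hgcont : ContinuousOn g (ball (0 : ℝ³) 2) := by
    refine ((contDiff_harmonicQuadratic (n := 0)).continuous.continuousOn.sub continuousOn_const).sub
      (continuous_const.inner continuous_id).continuousOn |>.sub ?_
    exact fun x hx => (hfar x hx).1.continuousAt.continuousWithinAt
  have hg0 : EqOn g (fun _ => (0 : ℝ)) (ball (0 : ℝ³) 2) :=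
    Measure.eqOn_open_of_ae_eq hgae isOpen_ball hgcont continuousOn_const
  -- evaluate at the four points `(±½, ±½, 0)`
  have habs : |(1 / 2 : ℝ)| = 1 / 2 := abs_of_pos (by norm_num)
  have habs' : |(-(1 / 2) : ℝ)| = 1 / 2 := by rw [abs_neg, habs]
  have ev : ∀ s t : ℝ, |s| = 1 / 2 → |t| = 1 / 2 → s * t - c - (s * a 0 + t * a 1) - p₂ 0 = 0 := by
    intro s t hs ht
    have hmem' := testPoint_mem_ball hs ht
    have h := hg0 hmem'
    simp only [hg, harmonicQuadratic_testPoint, inner_testPoint, hconst _ hmem'] at h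
    exact h
  have e1 := ev (1 / 2) (1 / 2) habs habs
  have e2 := ev (-(1 / 2)) (-(1 / 2)) habs' habs'
  have e3 := ev (1 / 2) (-(1 / 2)) habs habs'
  have e4 := ev (-(1 / 2)) (1 / 2) habs' habs
  linarith

/-! ## The stub with the gradient bound deleted is false -/

/-- The fixed bump of the line (Mathlib's smooth bump at `0`, `= 1` on `B̄₁`, supported in `B₂`). -/
def lineBump : ℝ³ → ℝ := (⟨1, 2, zero_lt_one, one_lt_two⟩ : ContDiffBump (0 : ℝ³))

/-- VERBATIM the statement of the lead's stub `stub_fplSlicePressure` (skeleton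
`Cruxes/FarPastLedger/Lines/uloc_gronwall_transplant.lean`, sha d1056eeb) with the single hypothesis
`(∀ x, ‖fderiv ℝ q x‖ ≤ L)` (and its parameter `L`) DELETED. -/
def SlicePressureWithoutGradBound : Prop :=
  ∃ c₀ : ℝ, 0 ≤ c₀ ∧
    ∀ (M : ℝ) (w : ℝ³ → ℝ³) (q : ℝ³ → ℝ),
    ContDiff ℝ (⊤ : ℕ∞) w → ContDiff ℝ (⊤ : ℕ∞) q → VectorCalculus.IsDivFree w →
    (∀ x, ‖w x‖ ≤ M) →
    (∀ x, Laplacian.laplacian q x = -VectorCalculus.divergence (convect w w) x) →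
    ∃ a : ℝ³,
      (∀ x₀ : ℝ³, ∃ (c : ℝ) (p₁ p₂ : ℝ³ → ℝ),
        (∀ x ∈ ball x₀ 2, q x = c + inner ℝ a x + p₁ x + p₂ x) ∧ MemLp p₁ 2 volume ∧
        ∫ x, p₁ x ^ 2 ≤ c₀ * M ^ 2 * ∫ x in ball x₀ 4, ‖w x‖ ^ 2 ∧
        ∀ x ∈ ball x₀ 2, DifferentiableAt ℝ p₂ x ∧
          ‖fderiv ℝ p₂ x‖ ≤ c₀ * ∫ y in (ball x₀ 3)ᶜ, ‖w y‖ ^ 2 / ‖y - x₀‖ ^ 4) ∧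
      ∀ r : ℝ, 1 ≤ r →
        ‖(∫ x, lineBump (r⁻¹ • x))⁻¹ • (∫ x, (lineBump (r⁻¹ • x)) • gradient q x) - a‖ ≤ c₀ * M ^ 2 / r

/-- The zero field is divergence free. -/
theorem isDivFree_zero : VectorCalculus.IsDivFree (fun _ : ℝ³ => (0 : ℝ³)) := fun x => by
  simp [VectorCalculus.divergence]

/-- `(0·∇)0 = 0`. -/
theorem convect_zero : convect (fun _ : ℝ³ => (0 : ℝ³)) (fun _ : ℝ³ => (0 : ℝ³)) = fun _ => 0 := by
  funext x
  simp [convect]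

/-- **The gradient bound `‖∇q‖ ≤ L` of stub HA is load-bearing**: with it deleted the slice lemma
is FALSE — witness `M = 0`, `w = 0`, `q = y₀y₁` (harmonic, so `Δq = −div((w·∇)w) = 0`), ball
`B₂(0)`: the near bound forces `p₁ = 0` in `L²`, the far bound forces `∇p₂ = 0` on `B₂(0)`, and
`no_nearFar_decomposition_harmonicQuadratic` applies.  So HA must consume GRADP
(`stub_fplPressureGradientBound`): bounded `∇q` is what kills the harmonic polynomials of degree
`≥ 2` in the kernel of the pressure Poisson equation. -/
theorem slicePressure_false_without_gradBound : ¬ SlicePressureWithoutGradBound := by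
  rintro ⟨c₀, -, h⟩
  obtain ⟨a, hnear, -⟩ := h 0 (fun _ => 0) harmonicQuadratic contDiff_const contDiff_harmonicQuadratic
    isDivFree_zero (fun x => by simp) (fun x => by
      rw [laplacian_harmonicQuadratic x, convect_zero]
      simp [VectorCalculus.divergence])
  obtain ⟨c, p₁, p₂, hdec, hmem, hint, hfar⟩ := hnear 0
  refine no_nearFar_decomposition_harmonicQuadratic ⟨a, c, p₁, p₂, hdec, hmem, ?_, fun x hx => ⟨(hfar x hx).1, ?_⟩⟩
  · simpa using hint
  · have := (hfar x hx).2
    simpa using this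

end Summit.NavierStokesRegularity.NavierStokesRegularity.Theorems.FarPastLedger.Negative

end
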